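import Summits.CriticalPhenomena.CardyFormulaZ2.Theorems.CardyAnchoredRigiditySubseqCardySquareHalf
import Summits.CriticalPhenomena.CardyFormulaZ2.Theorems.CardyAnchoredRigiditySubseqCardyJointLimit
import Summits.CriticalPhenomena.CardyFormulaZ2.Theorems.RectilinearCardy.Negative.RectilinearCardySquareInstance

/-!
# Cardy's formula for squares: bond percolation on `ℤ²` crosses every square with probability `→ 1/2`
# (crux `SubseqCardy`, stmt-CriticalPhenomena-5768, line `registered`: structure of joint limits, part 6)

Route `CardyAnchoredRigidity` (decl shared with `CardyLocalRigidity`), sub-problem `CardyFormulaZ2`.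
The conjunct `CardyFormulaZ2` is `∀ R, R.HasCrossingLimit (bondDomainCrossingProb R) cardyFunction`.
This file proves it, unconditionally, for SQUARES (conformal modulus `1/2`, where `F(1/2) = 1/2`):

* `JointLimit.btSquare_eq_half`, `JointLimit.lrSquare_eq_half` — every joint sequential limit `g`
  of the bond-`ℤ²` crossing probabilities gives EVERY axis-parallel square (any size, any position,
  crossed bottom-to-top or left-to-right) the value `1/2`: the unit box by part 5
  (`JointLimit.btUnitBox_eq_half`), every other square by the structure theory of parts 2–3 —
  dilations intertwine joint limits (`JointLimit.tendsto_dilate`: `R ↦ g (s·R)` is the joint limit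
  along `u n / s`, to which part 5 applies again), translation invariance (`JointLimit.map_addLeft`),
  and for the left-to-right marking the lattice symmetry `x + iy ↦ y + ix` (`map_conj` then
  `map_mul_I`);
* `tendsto_bondDomainCrossingProb_btSquare` / `…_lrSquare` — hence the FULL limit
  `bondDomainCrossingProb R δ → 1/2` as `δ → 0⁺` for every such square `R` (every mesh sequence has a
  subsequence with a joint limit, `exists_strictMono_jointLimit`, S1 of this line);
* `hasCrossingLimit_unitSquareQuad` — registered sub-goal `cardy_unitSquareQuad`: **Cardy's formula
  holds for the model square** `unitSquareQuad = (-1,1)²`: its modulus is `1/2` for every uniformizing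
  datum (`crossRatio_unitSquareQuad`, reflection in the diagonal) and `F(1/2) = 1/2`
  (`cardyFunction_half`). This is the instance `R = unitSquareQuad` of the summit conjunct
  `CardyFormulaZ2`, with G02's discretisation, at every mesh — previously recorded only as a
  consistency check the crux `RectilinearCardy` would imply
  (`tendsto_half_unitSquareQuad_of_rectilinearCardy`).

References: J. Cardy, J. Phys. A 25 (1992) L201; B. Bollobás, O. Riordan, *Percolation* (2006),
Ch. 3 Lemma 1, Ch. 7 §7.1; O. Schramm, S. Smirnov, Ann. Probab. 39 (2011) §5.
-/

noncomputable section

namespace Summit.CriticalPhenomena.CardyFormulaZ2.Cruxes.SubseqCardy.Birth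

open Set Filter Topology Metric Complex
open Literature.Probability.RandomPlanarGeometry (ConformalRectangle MarkedDomain cardyFunction)
open Literature.Probability.LatticeModels
open Literature.Probability.Percolation (bondDomainCrossingProb unitSquareQuad unitSquareQuad_carrier rectQuad)
open Summit.CriticalPhenomena.CardyFormulaZ2.Theorems.RectilinearCardy.Negative (crossRatio_unitSquareQuad
  cardyFunction_half)

namespace JointLimit

variable {u : ℕ → ℝ} {g : ConformalRectangle → ℝ}

/-! ### Images of coordinate rectangles under coordinatewise maps -/

/-- A map acting coordinatewise, `F (x + iy) = f x + i h y`, maps `S × T` onto `f(S) × h(T)`.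
[folklore] -/
theorem image_reProdIm_of_re_im {F : ℂ → ℂ} {f h : ℝ → ℝ} (hF : ∀ z, (F z).re = f z.re ∧ (F z).im = h z.im)
    (S T : Set ℝ) : F '' (S ×ℂ T) = (f '' S) ×ℂ (h '' T) := by
  ext z
  simp only [mem_image, Complex.mem_reProdIm]
  constructor
  · rintro ⟨p, ⟨hp1, hp2⟩, rfl⟩
    exact ⟨⟨p.re, hp1, (hF p).1.symm⟩, ⟨p.im, hp2, (hF p).2.symm⟩⟩
  · rintro ⟨⟨x, hx, hxz⟩, ⟨y, hy, hyz⟩⟩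
    refine ⟨⟨x, y⟩, ⟨hx, hy⟩, ?_⟩
    apply Complex.ext
    · rw [(hF _).1]; exact hxz
    · rw [(hF _).2]; exact hyz

/-- A map swapping the coordinates, `F (x + iy) = h y + i f x`, maps `S × T` onto `h(T) × f(S)`.
[folklore] -/
theorem image_reProdIm_of_im_re {F : ℂ → ℂ} {f h : ℝ → ℝ} (hF : ∀ z, (F z).re = h z.im ∧ (F z).im = f z.re)
    (S T : Set ℝ) : F '' (S ×ℂ T) = (h '' T) ×ℂ (f '' S) := by
  ext z
  simp only [mem_image, Complex.mem_reProdIm]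
  constructor
  · rintro ⟨p, ⟨hp1, hp2⟩, rfl⟩
    exact ⟨⟨p.im, hp2, (hF p).1.symm⟩, ⟨p.re, hp1, (hF p).2.symm⟩⟩
  · rintro ⟨⟨y, hy, hyz⟩, ⟨x, hx, hxz⟩⟩
    refine ⟨⟨x, y⟩, ⟨hx, hy⟩, ?_⟩
    apply Complex.ext
    · rw [(hF _).1]; exact hyz
    · rw [(hF _).2]; exact hxz

/-- A horizontal side `[a, b] × {t}` as a set of complex numbers. [folklore] -/
theorem setOf_im_eq_re_mem (a b t : ℝ) : {z : ℂ | z.im = t ∧ z.re ∈ Icc a b} = (Icc a b ×ℂ {t}) := by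
  ext z; simp [Complex.mem_reProdIm, and_comm]

/-- A vertical side `{t} × [a, b]` as a set of complex numbers. [folklore] -/
theorem setOf_re_eq_im_mem (a b t : ℝ) : {z : ℂ | z.re = t ∧ z.im ∈ Icc a b} = ({t} ×ℂ Icc a b) := by
  ext z; simp [Complex.mem_reProdIm]

/-! ### All squares, bottom-to-top -/

/-- **Every joint sequential limit gives every axis-parallel square, crossed from its bottom to its
top side, the value `1/2`.** The square `(x₀, x₀+s) × (y₀, y₀+s)` has the carrier and arcs of the
translate by `x₀ + iy₀` of the dilate by `s` of the unit box; `g` is translation invariant, and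
`R ↦ g (s·R)` is the joint limit along `u n / s`, for which the unit box has value `1/2` (part 5).
[folklore] -/
theorem btSquare_eq_half (hu : Tendsto u atTop (𝓝[>] (0 : ℝ)))
    (hg : ∀ R : ConformalRectangle, Tendsto (fun n => bondDomainCrossingProb R (u n)) atTop (𝓝 (g R)))
    {x₀ y₀ s : ℝ} (hs : 0 < s) (R : ConformalRectangle)
    (hc : R.carrier = (Ioo x₀ (x₀ + s) ×ℂ Ioo y₀ (y₀ + s)))
    (h0 : R.arc 0 = {z : ℂ | z.im = y₀ ∧ z.re ∈ Icc x₀ (x₀ + s)})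
    (h2 : R.arc 2 = {z : ℂ | z.im = y₀ + s ∧ z.re ∈ Icc x₀ (x₀ + s)}) : g R = 1 / 2 := by
  have hs' : (s : ℂ) ≠ 0 := Complex.ofReal_ne_zero.2 hs.ne'
  set D : ℂ ≃ₜ ℂ := Homeomorph.mulLeft₀ (s : ℂ) hs' with hD
  have hDz : ∀ z, D z = (s : ℂ) * z := fun z => rfl
  have hDri : ∀ z, (D z).re = s * z.re ∧ (D z).im = s * z.im := fun z => by
    rw [hDz]; simp
  set e : ℂ := ⟨x₀, y₀⟩ with he
  have hEri : ∀ z, ((fun w => e + w) z).re = (fun x => x₀ + x) z.re ∧ ((fun w => e + w) z).im = (fun y => y₀ + y) z.im :=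
    fun z => by simp [he]
  -- the dilated joint limit and its value on the unit box
  have hg' : ∀ R : ConformalRectangle,
      Tendsto (fun n => bondDomainCrossingProb R (u n / s)) atTop (𝓝 (g (R.map D))) :=
    fun R => tendsto_dilate hg hs D hDz R
  have hunit : g ((rectQuad 0 1 0 1 one_pos one_pos).map D) = 1 / 2 :=
    btUnitBox_eq_half (g := fun R => g (R.map D)) (tendsto_div_const hu hs) hg'
  -- identify `R` with the translate of the dilate of the unit box
  have hcarrier : (((rectQuad 0 1 0 1 one_pos one_pos).map D).map (Homeomorph.addLeft e)).carrier = R.carrier := by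
    rw [MarkedDomain.carrier_map, MarkedDomain.carrier_map, Homeomorph.coe_addLeft, btBox_carrier, hc,
      image_reProdIm_of_re_im hDri, image_reProdIm_of_re_im hEri, image_mul_left_Ioo hs 0 1]
    simp only [mul_zero, mul_one, image_const_add_Ioo, add_zero]
  have harcs : ∀ t : ℝ, (fun w => e + w) '' (D '' {z : ℂ | z.im = t ∧ z.re ∈ Icc (0:ℝ) 1}) =
      {z : ℂ | z.im = y₀ + s * t ∧ z.re ∈ Icc x₀ (x₀ + s)} := by
    intro t
    rw [setOf_im_eq_re_mem, setOf_im_eq_re_mem, image_reProdIm_of_re_im hDri, image_reProdIm_of_re_im hEri,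
      image_mul_left_Icc hs.le zero_le_one]
    simp only [mul_zero, mul_one, image_const_add_Icc, add_zero, image_singleton]
  have harc0 : (((rectQuad 0 1 0 1 one_pos one_pos).map D).map (Homeomorph.addLeft e)).arc 0 = R.arc 0 := by
    rw [MarkedDomain.arc_map, MarkedDomain.arc_map, Homeomorph.coe_addLeft, btBox_arc_zero, harcs, h0]
    simp
  have harc2 : (((rectQuad 0 1 0 1 one_pos one_pos).map D).map (Homeomorph.addLeft e)).arc 2 = R.arc 2 := by
    rw [MarkedDomain.arc_map, MarkedDomain.arc_map, Homeomorph.coe_addLeft, btBox_arc_two, harcs, h2]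
    simp
  rw [← congr hg hcarrier harc0 harc2, map_addLeft hu hg, hunit]

/-! ### All squares, left-to-right -/

/-- **Every joint sequential limit gives every axis-parallel square, crossed from its left to its
right side, the value `1/2`** (the lattice symmetry `x + iy ↦ y + ix`, complex conjugation followed
by the quarter turn, exchanges the two markings: `map_conj`, `map_mul_I`). [folklore] -/
theorem lrSquare_eq_half (hu : Tendsto u atTop (𝓝[>] (0 : ℝ)))
    (hg : ∀ R : ConformalRectangle, Tendsto (fun n => bondDomainCrossingProb R (u n)) atTop (𝓝 (g R)))
    {x₀ y₀ s : ℝ} (hs : 0 < s) (R : ConformalRectangle)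
    (hc : R.carrier = (Ioo x₀ (x₀ + s) ×ℂ Ioo y₀ (y₀ + s)))
    (h0 : R.arc 0 = {z : ℂ | z.re = x₀ ∧ z.im ∈ Icc y₀ (y₀ + s)})
    (h2 : R.arc 2 = {z : ℂ | z.re = x₀ + s ∧ z.im ∈ Icc y₀ (y₀ + s)}) : g R = 1 / 2 := by
  -- the bottom-to-top square `(y₀, y₀+s) × (x₀, x₀+s)`, reflected in the diagonal
  set C : ℂ ≃ₜ ℂ := Complex.conjCLE.toHomeomorph with hC
  set Q : ℂ ≃ₜ ℂ := Homeomorph.mulLeft₀ I I_ne_zero with hQ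
  have hCz : ∀ z, C z = (starRingEnd ℂ) z := fun z => rfl
  have hQz : ∀ z, Q z = I * z := fun z => rfl
  have hF : ∀ z, ((fun w => Q (C w)) z).re = id z.im ∧ ((fun w => Q (C w)) z).im = id z.re := fun z => by
    simp [hQz, hCz]
  set B : ConformalRectangle := rectQuad 0 1 0 1 one_pos one_pos with hB
  -- a bottom-to-top square `S` with the right carrier: the model square moved to `(y₀, x₀)`
  have hval : ∀ S : ConformalRectangle, S.carrier = (Ioo y₀ (y₀ + s) ×ℂ Ioo x₀ (x₀ + s)) →
      S.arc 0 = {z : ℂ | z.im = x₀ ∧ z.re ∈ Icc y₀ (y₀ + s)} →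
      S.arc 2 = {z : ℂ | z.im = x₀ + s ∧ z.re ∈ Icc y₀ (y₀ + s)} →
      g ((S.map C).map Q) = 1 / 2 := by
    intro S hSc hS0 hS2
    rw [map_mul_I hg Q hQz, map_conj hg C hCz]
    exact btSquare_eq_half hu hg hs S hSc hS0 hS2
  -- such an `S` exists: the rectangle `rectQuad y₀ (y₀+s) x₀ (x₀+s)`
  set S : ConformalRectangle := Literature.Probability.Percolation.rectQuad y₀ (y₀ + s) x₀ (x₀ + s)
    (by linarith) (by linarith) with hSdef
  have hSc : S.carrier = (Ioo y₀ (y₀ + s) ×ℂ Ioo x₀ (x₀ + s)) :=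
    Literature.Probability.Percolation.rectQuad_carrier _ _
  have hS0 : S.arc 0 = {z : ℂ | z.im = x₀ ∧ z.re ∈ Icc y₀ (y₀ + s)} := by
    ext z; exact Literature.Probability.Percolation.mem_rectQuad_arc_zero _ _
  have hS2 : S.arc 2 = {z : ℂ | z.im = x₀ + s ∧ z.re ∈ Icc y₀ (y₀ + s)} := by
    ext z; exact Literature.Probability.Percolation.mem_rectQuad_arc_two _ _
  -- and its reflected image has the carrier and arcs of `R`
  have himg : ∀ X : Set ℂ, Q '' (C '' X) = (fun w => Q (C w)) '' X := fun X => image_image _ _ _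
  have hcR : ((S.map C).map Q).carrier = R.carrier := by
    rw [MarkedDomain.carrier_map, MarkedDomain.carrier_map, himg, hSc, image_reProdIm_of_im_re hF, hc,
      image_id, image_id]
  have h0R : ((S.map C).map Q).arc 0 = R.arc 0 := by
    rw [MarkedDomain.arc_map, MarkedDomain.arc_map, himg, hS0, setOf_im_eq_re_mem, image_reProdIm_of_im_re hF,
      h0, setOf_re_eq_im_mem, image_id, image_id]
  have h2R : ((S.map C).map Q).arc 2 = R.arc 2 := by
    rw [MarkedDomain.arc_map, MarkedDomain.arc_map, himg, hS2, setOf_im_eq_re_mem, image_reProdIm_of_im_re hF,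
      h2, setOf_re_eq_im_mem, image_id, image_id]
  rw [← congr hg hcR h0R h2R]
  exact hval S hSc hS0 hS2

end JointLimit

/-! ### Full limits: the critical square is crossed with probability `→ 1/2` -/

/-- **Every axis-parallel square, crossed bottom-to-top, has bond-`ℤ²` crossing probability `→ 1/2`
as the mesh `δ → 0⁺`** (every mesh sequence has a subsequence with a joint limit —
`exists_strictMono_jointLimit`, S1 — whose value on the square is `1/2`). [folklore] -/
theorem tendsto_bondDomainCrossingProb_btSquare {x₀ y₀ s : ℝ} (hs : 0 < s) (R : ConformalRectangle)
    (hc : R.carrier = (Ioo x₀ (x₀ + s) ×ℂ Ioo y₀ (y₀ + s)))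
    (h0 : R.arc 0 = {z : ℂ | z.im = y₀ ∧ z.re ∈ Icc x₀ (x₀ + s)})
    (h2 : R.arc 2 = {z : ℂ | z.im = y₀ + s ∧ z.re ∈ Icc x₀ (x₀ + s)}) :
    Tendsto (bondDomainCrossingProb R) (𝓝[>] (0:ℝ)) (𝓝 (1 / 2)) := by
  refine tendsto_of_subseq_tendsto fun ns hns => ?_
  obtain ⟨φ, hφ, g, hg⟩ := exists_strictMono_jointLimit ns hns
  refine ⟨φ, ?_⟩
  have hu : Tendsto (fun n => ns (φ n)) atTop (𝓝[>] (0:ℝ)) := hns.comp hφ.tendsto_atTop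
  rw [← JointLimit.btSquare_eq_half hu hg hs R hc h0 h2]
  exact hg R

/-- **Every axis-parallel square, crossed left-to-right, has bond-`ℤ²` crossing probability `→ 1/2`
as the mesh `δ → 0⁺`.** [folklore] -/
theorem tendsto_bondDomainCrossingProb_lrSquare {x₀ y₀ s : ℝ} (hs : 0 < s) (R : ConformalRectangle)
    (hc : R.carrier = (Ioo x₀ (x₀ + s) ×ℂ Ioo y₀ (y₀ + s)))
    (h0 : R.arc 0 = {z : ℂ | z.re = x₀ ∧ z.im ∈ Icc y₀ (y₀ + s)})
    (h2 : R.arc 2 = {z : ℂ | z.re = x₀ + s ∧ z.im ∈ Icc y₀ (y₀ + s)}) :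
    Tendsto (bondDomainCrossingProb R) (𝓝[>] (0:ℝ)) (𝓝 (1 / 2)) := by
  refine tendsto_of_subseq_tendsto fun ns hns => ?_
  obtain ⟨φ, hφ, g, hg⟩ := exists_strictMono_jointLimit ns hns
  refine ⟨φ, ?_⟩
  have hu : Tendsto (fun n => ns (φ n)) atTop (𝓝[>] (0:ℝ)) := hns.comp hφ.tendsto_atTop
  rw [← JointLimit.lrSquare_eq_half hu hg hs R hc h0 h2]
  exact hg R

/-- **Cardy's formula for the model square `(-1,1)²`** (the instance `R = unitSquareQuad` of the
conjunct `CardyFormulaZ2`, G02 discretisation, bond percolation on `ℤ²` at `p = 1/2`, unconditional):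
for every uniformizing datum `(φ, x)` of the square, `bondDomainCrossingProb unitSquareQuad δ →
F(crossRatio x)` as `δ → 0⁺` — the modulus of the square is `1/2` for every datum
(`crossRatio_unitSquareQuad`) and `F(1/2) = 1/2` (`cardyFunction_half`). [cite: CardyJPhysA1992] -/
theorem hasCrossingLimit_unitSquareQuad :
    unitSquareQuad.HasCrossingLimit (bondDomainCrossingProb unitSquareQuad) cardyFunction := by
  intro φ x hx
  rw [crossRatio_unitSquareQuad hx, cardyFunction_half]
  refine tendsto_bondDomainCrossingProb_btSquare (x₀ := -1) (y₀ := -1) two_pos unitSquareQuad ?_ ?_ ?_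
  · rw [unitSquareQuad_carrier]; norm_num
  · ext z
    rw [Literature.Probability.Percolation.SquareModel.mem_arc_zero, mem_setOf_eq]
    norm_num
  · ext z
    rw [Literature.Probability.Percolation.SquareModel.mem_arc_two, mem_setOf_eq]
    norm_num

/-- **Registered sub-goal `cardy_unitSquareQuad` (line `registered`, lead c3) — Cardy's formula holds
for the square**: `unitSquareQuad.HasCrossingLimit (bondDomainCrossingProb unitSquareQuad) cardyFunction`,
the `η = 1/2` instance of the summit conjunct `CardyFormulaZ2`, proved unconditionally from the
structure theory of joint sequential limits (parts 1–5). [cite: CardyJPhysA1992] -/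
theorem cardy_unitSquareQuad : Literature.Probability.RandomPlanarGeometry.ConformalRectangle.HasCrossingLimit Literature.Probability.Percolation.unitSquareQuad (Literature.Probability.Percolation.bondDomainCrossingProb Literature.Probability.Percolation.unitSquareQuad) Literature.Probability.RandomPlanarGeometry.cardyFunction :=
  hasCrossingLimit_unitSquareQuad

end Summit.CriticalPhenomena.CardyFormulaZ2.Cruxes.SubseqCardy.Birth

end
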